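import Summits.NavierStokesRegularity.NavierStokesRegularity.Theorems.BoundedTemperatureClosed.Negative.CollinearBites
import Summits.NavierStokesRegularity.NavierStokesRegularity.Theorems.TypeICertificateLadderNoTypeIBlowupTypeIMorrey
import Literature.Analysis.FluidPDE.AlbrittonKatoClassLocalLeray
import Literature.Analysis.FluidPDE.LocalTypeI

/-!
# Crux `BoundedTemperatureClosed` (stmt-NavierStokesRegularity-18303) — round-2 ideator k = 5:
# "temperature buys the Morrey budget" (sketch; first lemmas typed, glue proved, nothing claimed closed)

Card: `Ideas/temperature-buys-morrey-budget.md`.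

What is typed here (all over existing declarations):

* `NSTypeICeiling K` — the crux's membership predicate at the Euler end `θ = 1`
  (`typeIInfimumNotAttainedNS_iff : H ↔ ∃ K > 0, ¬ NSTypeICeiling K ∧ ∀ K' > K, NSTypeICeiling K'`
  is `Iff.rfl`, so the vocabulary matches the landed negative lemma p146867 / p150539).
* `UniformMorreyOfGlobalRate` — **FIRST LEMMA (load-bearing, provable now)**: for a classical
  Leray–Hopf solution on `ℝ³ × [0,S)` whose Type-I rate `√(S-t)‖w(t,x)‖ ≤ K` holds on ALL of `[0,S)`
  (exactly the crux's membership predicate, read classically via `exists_linked_maximalSmooth`,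
  p149636), the Morrey bound `∫_{B(x₁,ρ)} |w(t)|² ≤ Λ(K)·ρ` holds for EVERY `t ∈ [0,S)`, every centre
  and every radius `ρ ≤ √S`, with `Λ` depending on `K` ONLY — no witness energy, no
  solution-dependent radius. (The landed `ScaledEnergyBound` = stmt-2884 /
  `typeICertificateLadder_uniformMorrey_of_rate` has `Λ(C)` but a SOLUTION-DEPENDENT radius `r₀`,
  because its rate is only eventual; the uloc linear Grönwall of its docstring, re-derived gap-free
  by the TypeIConcentration disprover, gives `r₀ = √S` under the global rate.)
* `MildTypeICeilingIsLocalTypeI` — warm-up (provable now by bookkeeping: `exists_linked_maximalSmooth`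
  + contrapositive of `noTypeIBlowup_of_not_localTypeISingularityExists`): every member of the
  crux's `θ = 1` set is an Albritton–Barker local Type-I singularity.
* `BigClassCeiling K` / `BigClassAttain` — the compactness half of the crux's zero-datum core `¬H`
  in the BIG class (suitable weak solution on the unit parabolic ball, Type-I singular vertex,
  temperature-`K` profile bound): claimed THEOREM-GRADE from `UniformMorreyOfGlobalRate` +
  `SuitableCompactness_holds` + `PersistenceOfSingularities_holds` + `albrittonBarker2019_lemma_2_6_holds`.
* `ExactSchwartzReentry` — the residue that carries `¬H` (objection O1, named): FALSE in the
  cubic-heat sibling (card, §Toy model), hence the card's verdict on the crux AS FILED is "restate".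
* glue (proved): `BigClassAttain → ExactSchwartzReentry → ¬ TypeIInfimumNotAttainedNS`.
-/

noncomputable section

open MeasureTheory Set Filter Topology Metric Function
open scoped ENNReal
open Literature.Analysis.FluidPDE Literature.Analysis.FluidPDE.Tao2016
open Literature.Analysis.FunctionSpaces.EuclideanSpace (complexify norm_complexify)

-- nested summit namespace is the tree layout (D-0017)
set_option linter.dupNamespace false

namespace Summit.NavierStokesRegularity.NavierStokesRegularity.Cruxes.BoundedTemperatureClosed.Ideator5

/-- Physical space. -/
local notation "ℝ³" => EuclideanSpace ℝ (Fin 3)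

/-- **NS Schwartz-data `H¹⁰_df`-mild Type-I ceiling `K`** — the membership predicate of the crux's
set at `θ = 1` (verbatim the body of `nsTypeI[K]` of the Negative files). -/
def NSTypeICeiling (K : ℝ) : Prop :=
  ∃ u₀ : SchwartzMap ℝ³ ℝ³, VectorCalculus.IsDivFree ⇑u₀ ∧ ∃ S : ℝ, 0 < S ∧ ∃ u : ℝ → L2C,
    IsMildSolutionFor eulerForm (schwartzL2 u₀) (Ico 0 S) u ∧
    (∀ t ∈ Ico 0 S, eLpNorm (u t) ⊤ volume ≤ ENNReal.ofReal (K / Real.sqrt (S - t))) ∧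
    ¬ ∃ S' : ℝ, S < S' ∧ ∃ v : ℝ → L2C,
      IsMildSolutionFor eulerForm (schwartzL2 u₀) (Ico 0 S') v ∧ ∀ t ∈ Ico 0 S, v t = u t

/-- Vocabulary check: the registered open statement `H = TypeIInfimumNotAttainedNS` (p146867) reads,
through `NSTypeICeiling`, "some `K > 0` is not a ceiling although every `K' > K` is" — definitionally. -/
theorem typeIInfimumNotAttainedNS_iff :
    Theorems.BoundedTemperatureClosed.Negative.TypeIInfimumNotAttainedNS ↔
      ∃ K : ℝ, 0 < K ∧ ¬ NSTypeICeiling K ∧ ∀ K' : ℝ, K < K' → NSTypeICeiling K' :=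
  Iff.rfl

/-- **FIRST LEMMA — temperature buys the Morrey budget (energy-free, explicit radius).**
For every `K` there is `Λ = Λ(K)` (the uloc Grönwall gives `Λ = c·K²·e^{cK}`, `c` absolute) such
that: if `(w, p)` is classical on `[0,S)`, Leray–Hopf on `[0,S)` (`ν = 1`, `f = 0`; finite energy
pins the pressure to `RᵢRⱼ(wᵢwⱼ) + c(t)`), and the Type-I rate holds on the WHOLE interval,
`√(S - t)‖w(t,x)‖ ≤ K` for all `t ∈ [0,S)` and all `x`, then for every `t ∈ [0,S)`, every centre `x₁`
and every radius `0 < ρ ≤ √S`: `∫_{B(x₁,ρ)} |w(t)|² ≤ Λ ρ`.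
Proof sketch (paper, ≤ 1 page; every input in tree): for `S - t ≥ ρ²` the pointwise rate gives
`≤ (4π/3)K²ρ`; for `t ∈ [S-ρ², S)` run the local energy identity on `φ_{x₁,ρ}` with
`ℰ(s) := sup_{y} ∫_{B(y,ρ)}|w(s)|²`: every flux term (`|w|²Δφ`, `|w|²w·∇φ`, near pressure
`RᵢRⱼ(χwᵢwⱼ)`, far pressure oscillation over dyadic shells) is LINEAR in `ℰ` with coefficient
`c₁ρ⁻² + c₂ρ⁻¹‖w(s)‖_∞`, whose integral over `[S-ρ², S)` is `≤ c₁ + 2c₂K` by the rate; Grönwall from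
the entry time `S - ρ²` (deposit `≤ (32π/3)K²ρ`). No global energy enters the constants. -/
def UniformMorreyOfGlobalRate : Prop :=
  ∀ K : ℝ, ∃ Λ : ℝ, ∀ S : ℝ, 0 < S →
    ∀ (w : ℝ → ℝ³ → ℝ³) (p : ℝ → ℝ³ → ℝ),
      IsClassicalNSSolutionOn (Ico 0 S) 1 0 w p → IsLerayHopfOn S 1 0 (w 0) w →
      (∀ t ∈ Ico 0 S, ∀ x, Real.sqrt (S - t) * ‖w t x‖ ≤ K) →
      ∀ t ∈ Ico 0 S, ∀ (x₁ : ℝ³) (ρ : ℝ), 0 < ρ → ρ ^ 2 ≤ S →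
        ∫ x in ball x₁ ρ, ‖w t x‖ ^ 2 ≤ Λ * ρ

/-- **Warm-up (provable now, bookkeeping): every member of the crux's `θ = 1` set is a local Type-I
singularity in Albritton–Barker's sense.** Compose `exists_linked_maximalSmooth` (p149636: the mild
blow-up IS a maximal smooth Leray–Hopf solution `w` with `w 0 = u₀`, `u t = [(w t)^ℂ]` a.e.) with the
contrapositive of the landed `noTypeIBlowup_of_not_localTypeISingularityExists`
(route TypeICertificateLadder). -/
def MildTypeICeilingIsLocalTypeI : Prop :=
  ∀ K : ℝ, NSTypeICeiling K → LocalTypeISingularityExists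

/-- **The warm-up is a theorem now** (bookkeeping on landed results, as announced): a Schwartz-data
`H¹⁰_df`-mild Type-I blow-up of Navier–Stokes is, classically, a maximal smooth Leray–Hopf solution
from a rapidly decaying datum with the Type-I rate (`exists_linked_maximalSmooth`, p149636; the
`L^∞` bound passes from the a.e. complexified slice to the continuous classical slice), so the
landed `noTypeIBlowup_of_not_localTypeISingularityExists` (route TypeICertificateLadder) would extend
it smoothly past `S` if no local Type-I singularity existed — contradicting maximality. -/
theorem mildTypeICeilingIsLocalTypeI : MildTypeICeilingIsLocalTypeI := by
  intro K hK
  have hKpos : 0 < K := Theorems.BoundedTemperatureClosed.Negative.pos_of_nsTypeI hK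
  obtain ⟨u₀, hdiv, S, hS, u, hu, hrate, hnoext⟩ := hK
  by_contra hno
  obtain ⟨w, p, hmax, hLH, hw0, hlink⟩ :=
    Theorems.BoundedTemperatureClosed.Negative.exists_linked_maximalSmooth u₀ hdiv hS hu hnoext
  have hdec : HasRapidSpatialDecay (w 0) := by
    rw [hw0]
    exact Theorems.PumpContinuationMildBlowupClassical.hasRapidSpatialDecay_schwartz u₀
  -- the Type-I rate of the classical solution, everywhere in space, for every `t ∈ [0,S)`
  have hTI : IsTypeIBlowup w S := by
    refine ⟨K, ?_⟩
    filter_upwards [Ico_mem_nhdsLT hS] with t ht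
    have heq : eLpNorm ((u t : L2C) : ℝ³ → EuclideanSpace ℂ (Fin 3)) ⊤ volume =
        eLpNorm (w t) ⊤ volume := by
      rw [eLpNorm_congr_ae (hlink t ht)]
      exact eLpNorm_congr_norm_ae (Eventually.of_forall fun x => by
        rw [Function.comp_apply, norm_complexify])
    have hup : eLpNorm (w t) ⊤ volume ≤ ENNReal.ofReal (K / Real.sqrt (S - t)) := by
      rw [← heq]
      exact hrate t ht
    have hKt : 0 ≤ K / Real.sqrt (S - t) := div_nonneg hKpos.le (Real.sqrt_nonneg _)
    exact forall_norm_le_of_ae_norm_le_of_continuous (hmax.1.contDiff_velocity ht).continuous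
      (ae_norm_le_of_eLpNorm_top_le_ofReal hKt hup)
  have hext : HasSmoothExtensionPast 1 0 w S :=
    Theorems.noTypeIBlowup_of_not_localTypeISingularityExists hno 1 S one_pos hS w p hmax.1 hLH hdec hTI
  exact hmax.2 hext

/-- **The big class at temperature `K`**: a suitable weak solution `(u, p)` of Navier–Stokes in the
unit parabolic ball `Q((0,0), 1) = (-1,0) × B(0,1)` whose vertex `(0,0)` is a local Type-I singular
point in Albritton–Barker's sense (`𝐈 < ∞` over all parabolic sub-balls) and which obeys the
temperature-`K` profile bound `√(-t)|u(t,x)| ≤ K` a.e. in the ball. No decay, no datum class: this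
is what limits of translated, time-normalised Schwartz witnesses of bounded temperature retain. -/
def BigClassCeiling (K : ℝ) : Prop :=
  ∃ (u : ℝ → ℝ³ → ℝ³) (p : ℝ → ℝ³ → ℝ),
    IsLocalTypeISingularPoint 1 ((0 : ℝ), (0 : ℝ³)) u p ∧
    ∀ᵐ z ∂(volume.restrict (Literature.Analysis.FluidPDE.parabolicCylinder 1 ((0 : ℝ), (0 : ℝ³)))),
      Real.sqrt (-z.1) * ‖u z.1 z.2‖ ≤ K

/-- **Big-class attainment (the compactness half of `¬H`; claimed theorem-grade).** If every
`K' > K > 0` is a Schwartz Type-I ceiling of Navier–Stokes then `K` is a BIG-CLASS ceiling: normalise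
the witnesses to `S = 1`, translate an (earliest-time) singular point to the origin, read them
classically (`exists_linked_maximalSmooth`), get `A ≤ Λ(2K)` on every parabolic sub-ball of
`Q((1,0),1)` from `UniformMorreyOfGlobalRate` (uniformly in the witness — this is where the
energy-free constant is load-bearing), hence `𝐈 ≤ c(K)` by `albrittonBarker2019_lemma_2_6_holds`,
hence the uniform `L³(Q₁)`/`L^{3/2}(Q₁)` bound that `SuitableCompactness_holds` and
`PersistenceOfSingularities_holds` ask for; the limit keeps `𝐈 ≤ c(K)` (lower semicontinuity) and
the profile bound with constant `inf K' = K`. -/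
def BigClassAttain : Prop :=
  ∀ K : ℝ, 0 < K → (∀ K' : ℝ, K < K' → NSTypeICeiling K') → BigClassCeiling K

/-- **Exact Schwartz re-entry — the residue that carries `¬H` (objection O1, named).** A big-class
Type-I singularity of temperature `K` is realised, at the SAME ceiling `K`, by a Schwartz-data
`H¹⁰_df`-mild blow-up. Open for Navier–Stokes and FALSE in the cubic-heat sibling
`uₜ = Δu + |u|²u` on `ℝ³` (card §Toy model: there the Schwartz ceiling set is the OPEN ray
`(1/√2, ∞)`, the big-class set the CLOSED ray `[1/√2, ∞)`). Not proposed as a stub; typed to make the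
split of the crux's open core explicit. -/
def ExactSchwartzReentry : Prop :=
  ∀ K : ℝ, 0 < K → BigClassCeiling K → NSTypeICeiling K

/-- **Glue (proved): the zero-datum core `¬H` of the crux is exactly big-class attainment plus exact
re-entry.** Neither conjunct alone is refuted by `H` (the first is claimed provable, the second is
the model-false residue), so the split is honest in the sense of TRIAGE-r1 criterion (iv). -/
theorem not_typeIInfimumNotAttainedNS_of_bigClassAttain_of_reentry
    (hA : BigClassAttain) (hR : ExactSchwartzReentry) :
    ¬ Theorems.BoundedTemperatureClosed.Negative.TypeIInfimumNotAttainedNS := by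
  rw [typeIInfimumNotAttainedNS_iff]
  rintro ⟨K, hK, hnot, hall⟩
  exact hnot (hR K hK (hA K hK hall))

/-- **Door-type accumulation at a datum** (the hypothesis of the repaired Link AtOne at `(𝒜, M)`):
bounded-temperature blow-up parameters of the segment of `𝒜` accumulate at the Euler end from the
left. -/
def AccumulatesAtOne (𝒜 : AveragingDatum) (M : ℝ) : Prop :=
  ∀ δ : ℝ, 0 < δ → ∃ θ : ℝ, 1 - δ < θ ∧ θ < 1 ∧ 0 ≤ θ ∧
    ∃ u₀ : SchwartzMap ℝ³ ℝ³, VectorCalculus.IsDivFree ⇑u₀ ∧ ∃ S : ℝ, 0 < S ∧ ∃ u : ℝ → L2C,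
      IsMildSolutionFor (fun a b c => ((1 - θ : ℝ) : ℂ) * 𝒜.form a b c + ((θ : ℝ) : ℂ) * eulerForm a b c)
        (schwartzL2 u₀) (Ico 0 S) u ∧
      (∀ t ∈ Ico 0 S, eLpNorm (u t) ⊤ volume ≤ ENNReal.ofReal (M / Real.sqrt (S - t))) ∧
      ¬ ∃ S' : ℝ, S < S' ∧ ∃ v : ℝ → L2C,
        IsMildSolutionFor (fun a b c => ((1 - θ : ℝ) : ℂ) * 𝒜.form a b c + ((θ : ℝ) : ℂ) * eulerForm a b c)
          (schwartzL2 u₀) (Ico 0 S') v ∧ ∀ t ∈ Ico 0 S, v t = u t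

/-- **Endpoint object for the repaired Link** (what the lever delivers at `θ = 1` for data whose
segment obeys an NS-type local energy inequality — the collinear sector trivially, the Door's LOCAL
cascade datum by the card's second lemma; general `𝒜` is subject to BN1): Door-type accumulation at
`(𝒜, M)` produces a local Type-I singularity of TRUE Navier–Stokes. On the collinear sector this is
already `MildTypeICeilingIsLocalTypeI` after `mem_btSet_iff_of_form_eq_smul` (p154830). -/
def EndpointLocalTypeI (𝒜 : AveragingDatum) : Prop :=
  ∀ M : ℝ, AccumulatesAtOne 𝒜 M → LocalTypeISingularityExists

/-- **The collinear sector of the repaired Link is settled (PROVED): for data with `B̃_𝒜 = κ·B` on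
`H¹⁰_df` (every real `κ`; they exist, `exists_form_eq_smul_eulerForm`, p154830), Door-type accumulation
at `(𝒜, M)` yields an Albritton–Barker local Type-I singularity of Navier–Stokes** — a member
`θ ∈ (1-δ, 1)` with `δ = 1/(2(1+|κ|))` has `c = (1-θ)κ + θ ≥ 1/2 > 0`, rescales to `nsTypeI[cM]`
(`mem_btSet_iff_of_form_eq_smul`), and `mildTypeICeilingIsLocalTypeI` applies. No compactness. -/
theorem endpointLocalTypeI_of_form_eq_smul {𝒜 : AveragingDatum} {κ : ℝ}
    (hκ : ∀ u v w : L2C, MemH10df u → MemH10df v → MemH10df w →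
      𝒜.form u v w = ((κ : ℝ) : ℂ) * eulerForm u v w) : EndpointLocalTypeI 𝒜 := by
  intro M hacc
  set δ : ℝ := 1 / (2 * (1 + |κ|)) with hδ
  have hκ0 : 0 ≤ |κ| := abs_nonneg κ
  have hδpos : 0 < δ := by rw [hδ]; positivity
  obtain ⟨θ, h1, h2, h0, u₀, hdiv, S, hS, u, hu, hrate, hno⟩ := hacc δ hδpos
  have hδκ : δ + δ * |κ| = 1 / 2 := by
    rw [hδ]
    field_simp
  have hk : -((1 - θ) * |κ|) ≤ (1 - θ) * κ := by
    have h1θ : 0 ≤ 1 - θ := by linarith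
    have := neg_abs_le κ
    nlinarith
  have h3 : (1 - θ) * |κ| ≤ δ * |κ| :=
    mul_le_mul_of_nonneg_right (by linarith) hκ0
  have hc : 0 < (1 - θ) * κ + θ := by linarith
  refine mildTypeICeilingIsLocalTypeI _
    ((Theorems.BoundedTemperatureClosed.Negative.mem_btSet_iff_of_form_eq_smul hκ h0 h2.le hc M).1 ?_)
  exact ⟨⟨h0, h2.le⟩, u₀, hdiv, S, hS, u, hu, hrate, hno⟩

/-- The Door supplies accumulation at its own datum and ceiling (definitional unpacking of
`EulerProximatePump`). -/
theorem exists_accumulatesAtOne_of_door (h : Theses.PumpContinuation.EulerProximatePump) :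
    ∃ 𝒜 : AveragingDatum, 𝒜.IsSymmetric ∧ 𝒜.HasCancellation ∧ ∃ M : ℝ, AccumulatesAtOne 𝒜 M := by
  obtain ⟨𝒜, hs, hc, M, hM⟩ := h
  exact ⟨𝒜, hs, hc, M, hM⟩

/-- Hence, for any datum class on which `EndpointLocalTypeI` is proved (and which contains the Door's
datum), the Door alone refutes the Type-I Liouville picture: `Door → LocalTypeISingularityExists`. -/
theorem localTypeI_of_door_of_endpoint (hE : ∀ 𝒜 : AveragingDatum, 𝒜.IsSymmetric → 𝒜.HasCancellation →
      EndpointLocalTypeI 𝒜) (h : Theses.PumpContinuation.EulerProximatePump) :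
    LocalTypeISingularityExists := by
  obtain ⟨𝒜, hs, hc, M, hM⟩ := exists_accumulatesAtOne_of_door h
  exact hE 𝒜 hs hc M hM

end Summit.NavierStokesRegularity.NavierStokesRegularity.Cruxes.BoundedTemperatureClosed.Ideator5

end
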